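import Literature.MathematicalPhysics.QuantumFieldTheory.Balaban1983to89.B15Prop1PlaquetteLettersOfClass
import Literature.MathematicalPhysics.QuantumFieldTheory.Balaban1983to89.B15DeterminingSetsB

/-!
# `Balaban1983to89.B15Prop1PlaquetteLettersOfClass` — [Balaban1985Variational] (2) p. 278 ∕ [Balaban1988Convergent] (2.12)–(2.13) pp. 256–257: THE TWO PLAQUETTE — **BOND-DATUM EDITION** (`…B15Prop1PlaquetteLettersOfClassB`, USED DECLARATIONS ONLY): the print-datum ([Balaban1984PropagatorsII] (2.3)) twins of the declarations of `B15Prop1PlaquetteLettersOfClass` that N12's junction of record v14ᴸ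
uses with a datum-bearing statement (`norm_plaqHol_sub_one_le_of_isMinimizer_of_cornerBond`, `plaqSmallOn_towerBox_of_isMinimizer`) — class (γ) of dag-n12-c's census-by-declaration v2 (bus [DAGN12C-G35], 2026-08-30).  GENERATOR (block-extracted from the
parent's tree bytes by HOME `lean/g35/gen/gen_blocks.py`): namespace `…B`, SAME names, `DetSet ↦ BDetSet` (F0a), `AgreeOn ↦ AgreeOnB`, `IsMinimizer ↦ IsMinimizerB`, `bondsOf (𝐁 j) ↦ 𝔅 j`, `constrCard ∕
constrEnum ∕ ConstrSet ∕ msChart ↦ …B` (lane `Node00/MultiScaleFibreChartB`), `IsCritOnFibre ∕ IsFibreChartNear ↦ …B`; proofs VERBATIM; the parent's other (datum-free) declarations REUSED by `open`.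

statement-level skeleton of published theorems with citation tags; proofs where landed; nothing here is a claim about
the Yang–Mills mass gap

Cell `pub-ymgap` (HUMAN RULINGS D-0062 ∕ D-0149), lane `pub-ymgap-dag-n12-c` g35 (R134 seat (a), N12 = [B15], s1, lane owner); `--kind proof --supports` K1⁹ `stmt-QuantumFields-27364`; count-neutral.
THEOREMS ONLY (0 `def`, 0 `instance`, 0 `sorry`).  HONESTY GUARD (director-ym №338 (5)): PURELY ADDITIVE — the parent stays landed and true on its own text; nothing in it is edited; no displayed
premise of any consumer is deleted or weakened; every hypothesis stays a hypothesis.  Nothing of Bałaban's analysis asserted; N12 NOT discharged; K0⁷ ∕ K1⁹ NOT closed; one finite 𝕋⁴ programme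
at fixed ε — nothing continuum ∕ ℝ⁴ ∕ OS; the Yang–Mills mass gap (Clay) is NOT proved by any of this.

PARENT's DOCSTRING (mathematics and citations; read `𝐁` as the bond datum `𝔅`):
# `Balaban1983to89.B15Prop1PlaquetteLettersOfClass` — [Balaban1985Variational] (2) p. 278 ∕ [Balaban1988Convergent] (2.12)–(2.13) pp. 256–257: THE TWO PLAQUETTE
# LETTERS OF THE N12 DIRECT ROAD (`hPχ` on the `Ω₁(Z)`-touching plaquettes, `hPbox` on the tower boxes around inner `j`-sites) ARE READ OFF THE MINIMISER'S OWN (2.12) CLASS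

Honest framing: statement-level skeleton of published definitions with citation tags; proofs are lattice bookkeeping; nothing here is a claim about the Yang–Mills mass gap.

Cell `pub-ymgap`, HUMAN RULINGS D-0062 ∕ D-0149, node N12 = [B15], lane-owner seat `pub-ymgap-dag-n12-c` (g21; pen ρ4 of the lane's «DIRECT ROW» census); count-neutral helper of K1⁹
`stmt-QuantumFields-27364`.

WHAT.  The direct road's Prop-1 endpoints ((P2c)′ `N12Prop1DirectOfChartHalfExplicit`, dag-n12-d's (D1)′ ∕ (E1)′, the knit «12Q-DIRECT») display, inside their tolerance frame, two
letters about every (2.12) minimiser `U₀ ∈ U_k({Ω_j(Z)}, εreg)` of a guarded datum: `hPχ` — `‖U₀(∂p) − 1‖ ≤ δ` for every plaquette `p` with a corner-bond starting in `Ω₁(Z)` — and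
`hPbox` — `PlaqSmallOn` at `δ` on the fine box of half-width `Lʲ + (Lʲ−1)∕2` around `ι_j y` for every inner `j`-site `y` (`ι_j y ∈ Ω_j(Z)`, `1 ≤ j ≤ k`; the premise of dag-n12-w6's right
inverse `exists_rightInverse_letter`).  Both are CONSEQUENCES OF THE CLASS ITSELF — [15] (2): *«|U(∂p) − 1| < ε₀η_j² for p ∈ Ω_j»* (`Node00.regMSCoPOfRecord`, first conjunct, scale-`0`
domain = the support of record `Ω₁ +` one layer of `M₁`-cubes) — and of the geometry of the maximal sequence (2.13) (*«dist(Ω_n, Ωᶜ_{n−1}) ≥ LⁿξM₁»*, r11's `dist_maxDomT`; the support's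
layer, `Node00.cover_mem_hullD_one_of_within`), at ANY tolerance `δ ≥ εreg` (`η_j ≤ 1`).  So the endpoints' frame keeps ONE numeric floor `εreg ≤ δ i` in their place.

CONTENTS (namespace `Literature.MathematicalPhysics.QuantumFieldTheory.Balaban1983to89.B15Prop1PlaquetteLettersOfClass`; theorems only — no `def`, no `instance`, no `sorry`).
* §1 `eta_sq_le_one`, `dist1_plaqHol_lt_of_mem_class` (the class's first conjunct at level `j ≤ k`, tolerance weakened to `εreg`).
* §2 ★★ `norm_plaqHol_sub_one_le_of_isMinimizer_of_cornerBond` — the letter `hPχ` at any `δ ≥ εreg` (level `1`).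
* §3 ★★ `within_of_mem_boxPlaqs`, ★★★ `plaqSmallOn_towerBox_of_isMinimizer` — the letter `hPbox` at any `δ ≥ εreg` (level `j − 1` through `dist_maxDomT` for `j ≥ 2`; the support's
  `M₁`-layer for `j = 1`, radius `L + (L−1)∕2 ≤ M₁`).
* §4 ★★★ `hPχ_on_of_class`, ★★★ `hPbox_on_of_class` — the FAMILY forms: the endpoints' displayed binders `hPχ` ∕ `hPbox` VERBATIM (per instance, per guarded base field, per minimiser),
  from `0 ≤ εreg`, `εreg ≤ δ i` (+ `2 ≤ M₁`, `L + (L−1)∕2 ≤ M₁`, `LᵏM₁ ∣ 2L^{m+K}` for `hPbox`).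

HONEST SCOPE.  Reads the minimiser's class membership (`IsMinimizer….1`) and lattice geometry; the minimiser's EXISTENCE, [15] Thm 1 and everything analytic stay where they are;
count-neutral; N12 NOT discharged; K1⁹ NOT closed; one finite four-torus programme at fixed `ε = L^{-K}` — nothing continuum ∕ ℝ⁴ ∕ OS ∕ mass gap ∕ Clay.

## References
* [Balaban1985Variational] T. Bałaban, *The variational problem and background fields in renormalization group method for lattice gauge theories*, Commun. Math. Phys. 102
  (1985) 277–309, (2) p. 278, Thm 1 (8) p. 279.
* [Balaban1988Convergent] T. Bałaban, *Convergent renormalization expansions for lattice gauge theories*, Commun. Math. Phys. 119 (1988) 243–285, p. 255, (2.12)–(2.13) pp. 256–257.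
* [Balaban1989LargeFieldI] T. Bałaban, Commun. Math. Phys. 122 (1989) 175–202, Prop. 1 p. 194.
-/


noncomputable section
open scoped Matrix.Norms.L2Operator

namespace Literature.MathematicalPhysics.QuantumFieldTheory.Balaban1983to89.B15Prop1PlaquetteLettersOfClassB

open B15Prop1PlaquetteLettersOfClass


open T4Continuum B15DeterminingSets B15DeterminingSetsB GaugeField B8Eq17ClassAkV1 BlockAveraging
open T4CubeChartGnomonic (SU2)
open T4AxialGaugeSmallField (castSite boxPlaqs boxBonds)
open B15Prop1Carrier (plaqsInside)
open B14.Eq213MaximalDomains (side)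
open B14.Eq213DetSet (Bj maxDomT dist_maxDomT)
open B15Eq112TorusCover (lift cover cover_lift)
open B14DomainGeom (Within)
open B7Prop1Explicit (e e_apply)
open Literature.MathematicalPhysics.QuantumFieldTheory.BalabanImbrieJaffe1984to88.BIJ85Eq453GaugeField (qsstarGIter0)

variable {F : T4Family}



section

/-- ★★ **`hPχ` FROM THE CLASS**: for a (2.12) minimiser `U₀` over the class of record of `Z`'s maximal sequence at height `k ≥ 1`, every plaquette one of whose four boundary bonds
(in the endpoints' spelling) starts in `Ω₁(Z)` satisfies `‖U₀(∂p) − 1‖ ≤ δ` for any `δ ≥ εreg` — such a bond's source is a corner of `p` in `Ω₁(Z)`, the level-`1` set of the class.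
[cite: Balaban1985Variational, (2) p.278; Balaban1988Convergent, (2.12)–(2.13) pp.256–257; Balaban1989LargeFieldI, Prop. 1 p.194] -/
theorem norm_plaqHol_sub_one_le_of_isMinimizer_of_cornerBond (ν : Node00.Stage7Numerics) (Kt : ℕ) {k : ℕ} (hk : 1 ≤ k)
    (Z : Set (Site (F.P Kt) 0)) {𝔅 : BDetSet (F.P Kt)} {W : MSField (F.P Kt) SU2} {U₀ : GaugeField (F.P Kt) 0 SU2}
    (hmin : IsMinimizerB (Node00.avOfRecord F 2 Kt) (Node00.regMSCoPOfRecord F 2 ν Kt k (maxDomT ν.M₁ Z)) 𝔅 W U₀)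
    (hε : 0 ≤ ν.εreg) {δ : ℝ} (hδ : ν.εreg ≤ δ) (p : Plaq (F.P Kt) 0)
    (hp : (⟨p.src, p.μ⟩ : PBond (F.P Kt) 0) ∈ {b : PBond (F.P Kt) 0 | b.src ∈ maxDomT ν.M₁ Z 1} ∨
      (⟨p.src.shift p.μ, p.ν⟩ : PBond (F.P Kt) 0) ∈ {b : PBond (F.P Kt) 0 | b.src ∈ maxDomT ν.M₁ Z 1} ∨
      (⟨p.src.shift p.ν, p.μ⟩ : PBond (F.P Kt) 0) ∈ {b : PBond (F.P Kt) 0 | b.src ∈ maxDomT ν.M₁ Z 1} ∨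
      (⟨p.src, p.ν⟩ : PBond (F.P Kt) 0) ∈ {b : PBond (F.P Kt) 0 | b.src ∈ maxDomT ν.M₁ Z 1}) :
    ‖((GaugeField.plaqHol U₀ p : SU2) : Matrix (Fin 2) (Fin 2) ℂ) - 1‖ ≤ δ := by
  have hp' : p ∈ plaqsOf (Node00.topSeq (Node00.suppDomOfRecord F ν Kt (maxDomT ν.M₁ Z)) (maxDomT ν.M₁ Z) 1) := by
    rw [Node00.topSeq_of_ne_zero _ _ one_ne_zero, mem_plaqsOf]
    rcases hp with h | h | h | h
    · exact Or.inl h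
    · exact Or.inr (Or.inl h)
    · exact Or.inr (Or.inr (Or.inl h))
    · exact Or.inl h
  have h := dist1_plaqHol_lt_of_mem_class ν Kt k (maxDomT ν.M₁ Z) hmin.1 hε hk hp'
  have e : dist1 (GaugeField.plaqHol U₀ p) = ‖((GaugeField.plaqHol U₀ p : SU2) : Matrix (Fin 2) (Fin 2) ℂ) - 1‖ := rfl
  rw [e] at h
  linarith

end

section

/-- ★★★ **`hPbox` FROM THE CLASS**: for a (2.12) minimiser `U₀` over the class of record of `Z`'s maximal sequence at height `k ≥ 1` (`M₁ ≥ 2`, `L + (L−1)∕2 ≤ M₁`, `LᵏM₁ ∣ 2L^{m+K}`),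
every inner `j`-site `y` (`ι_j y ∈ Ω_j(Z)`, `1 ≤ j ≤ k`) has its fine box of half-width `Lʲ + (Lʲ−1)∕2` around `ι_j y` `δ`-plaquette-small for any `δ ≥ εreg`: a box plaquette's
source lies within `Lʲ + (Lʲ−1)∕2 ≤ LʲM₁ − 1` of `ι_j y`, hence over `Ω_{j−1}(Z)` (*«dist(Ω_j, Ωᶜ_{j−1}) ≥ LʲξM₁»*, `dist_maxDomT`) for `j ≥ 2`, and in the support's `M₁`-layer around
`Ω₁(Z)` for `j = 1` — a corner in the class's level-`(j−1)` set either way.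
[cite: Balaban1985Variational, (2) p.278; Balaban1988Convergent, p.255, (2.12)–(2.13) pp.256–257; Balaban1989LargeFieldI, Prop. 1 p.194] -/
theorem plaqSmallOn_towerBox_of_isMinimizer (ν : Node00.Stage7Numerics) (Kt : ℕ) {k : ℕ}
    (Z : Set (Site (F.P Kt) 0)) {𝔅 : BDetSet (F.P Kt)} {W : MSField (F.P Kt) SU2} {U₀ : GaugeField (F.P Kt) 0 SU2}
    (hmin : IsMinimizerB (Node00.avOfRecord F 2 Kt) (Node00.regMSCoPOfRecord F 2 ν Kt k (maxDomT ν.M₁ Z)) 𝔅 W U₀)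
    (hM2 : 2 ≤ ν.M₁) (hrad : (F.P Kt).L + ((F.P Kt).L - 1) / 2 ≤ ν.M₁) (hdiv : side (F.P Kt).L ν.M₁ k ∣ (F.P Kt).sitesPerDir 0)
    (hε : 0 ≤ ν.εreg) {δ : ℝ} (hδ : ν.εreg ≤ δ)
    {j : ℕ} (hj1 : 1 ≤ j) (hjk : j ≤ k) (y : Site (F.P Kt) j) (hy : embIter j y ∈ maxDomT ν.M₁ Z j) :
    PlaqSmallOn (boxPlaqs (fun κ => lift (F.P Kt) (embIter j y) κ - ((((F.P Kt).L ^ j : ℕ) : ℤ) + ((((F.P Kt).L ^ j - 1) / 2 : ℕ) : ℤ)))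
      (fun κ => lift (F.P Kt) (embIter j y) κ + ((((F.P Kt).L ^ j : ℕ) : ℤ) + ((((F.P Kt).L ^ j - 1) / 2 : ℕ) : ℤ))) : Set (Plaq (F.P Kt) 0)) δ U₀ := by
  intro p hp
  obtain ⟨z, hlo, hhi, hsrc⟩ := hp
  have hM1 : 1 ≤ ν.M₁ := le_trans (by norm_num) hM2
  have hW : Within ((((F.P Kt).L ^ j : ℕ) : ℤ) + ((((F.P Kt).L ^ j - 1) / 2 : ℕ) : ℤ)) (lift (F.P Kt) (embIter j y)) z :=
    within_of_mem_boxPlaqs hlo hhi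
  -- the source, read on the cover
  have hsrc' : p.src = cover (F.P Kt) z := hsrc
  -- a corner of `p` in the class's level-`(j-1)` set
  have hcorner : p ∈ plaqsOf (Node00.topSeq (Node00.suppDomOfRecord F ν Kt (maxDomT ν.M₁ Z)) (maxDomT ν.M₁ Z) (j - 1)) := by
    rw [mem_plaqsOf]
    refine Or.inl ?_
    rw [hsrc']
    rcases Nat.lt_or_ge j 2 with hj2 | hj2
    · -- `j = 1`: the support's `M₁`-layer around `Ω₁(Z)`
      obtain rfl : j = 1 := by omega
      rw [Nat.sub_self, Node00.topSeq_zero, Node00.suppDomOfRecord_eq]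
      have hr : ((((F.P Kt).L ^ 1 : ℕ) : ℤ) + ((((F.P Kt).L ^ 1 - 1) / 2 : ℕ) : ℤ)) ≤ (ν.M₁ : ℤ) := by
        rw [pow_one]; exact_mod_cast hrad
      have hW' : Within (ν.M₁ : ℤ) z (lift (F.P Kt) (embIter 1 y)) := fun i => by
        rw [abs_sub_comm]; exact (hW i).trans hr
      exact Node00.cover_mem_hullD_one_of_within (by omega) (by rw [cover_lift]; exact hy) hW'
    · -- `j ≥ 2`: over `Ω_{j-1}(Z)` by the printed distance condition
      obtain ⟨n, rfl⟩ : ∃ n, j = n + 1 := ⟨j - 1, by omega⟩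
      rw [Nat.add_sub_cancel, Node00.topSeq_of_ne_zero _ _ (by omega)]
      have hr := towerRadius_le_side_sub_one (F.P Kt).L_pos hM2 (n + 1)
      exact dist_maxDomT hM1 hdiv hjk (by rw [cover_lift]; exact hy) (fun i => (hW i).trans hr)
  have h := dist1_plaqHol_lt_of_mem_class ν Kt k (maxDomT ν.M₁ Z) hmin.1 hε (by omega) hcorner
  exact lt_of_lt_of_le h hδ

end

section
variable {F : T4Family}

/-- ★★ **`hPχ` FROM THE CLASS — TOUCHING EDITION** (the shape the bond-datum road's P1 letter has: LOCATED-2 of the lane's census, the support set of the (K′) family's velocity under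
print's [II] (2.3) datum is the set of bonds TOUCHING `Ω₁(Z)`): for a (2.12) minimiser `U₀` over the class of record of `Z`'s maximal sequence at height `k ≥ 1` and ANY bond datum `𝔅`,
every plaquette one of whose four boundary bonds has its source OR its target in `Ω₁(Z)` satisfies `‖U₀(∂p) − 1‖ ≤ δ` for any `δ ≥ εreg` — such an endpoint is one of the four corners of
`p` (`PBond.tgt = src.shift dir`, `Site.shift_comm`), all of which the class's level-`1` plaquette set `plaqsOf Ω₁(Z)` reads. [cite: Balaban1985Variational, (2) p.278; Balaban1988Convergent, (2.12)–(2.13) pp.256–257; Balaban1989LargeFieldI, Prop. 1 p.194; Balaban1984PropagatorsII, (2.3) p.224] -/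
theorem norm_plaqHol_sub_one_le_of_isMinimizer_of_cornerBond_touching (ν : Node00.Stage7Numerics) (Kt : ℕ) {k : ℕ} (hk : 1 ≤ k)
    (Z : Set (Site (F.P Kt) 0)) {𝔅 : BDetSet (F.P Kt)} {W : MSField (F.P Kt) SU2} {U₀ : GaugeField (F.P Kt) 0 SU2}
    (hmin : IsMinimizerB (Node00.avOfRecord F 2 Kt) (Node00.regMSCoPOfRecord F 2 ν Kt k (maxDomT ν.M₁ Z)) 𝔅 W U₀)
    (hε : 0 ≤ ν.εreg) {δ : ℝ} (hδ : ν.εreg ≤ δ) (p : Plaq (F.P Kt) 0)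
    (hp : (⟨p.src, p.μ⟩ : PBond (F.P Kt) 0) ∈ {b : PBond (F.P Kt) 0 | b.src ∈ maxDomT ν.M₁ Z 1 ∨ b.tgt ∈ maxDomT ν.M₁ Z 1} ∨
      (⟨p.src.shift p.μ, p.ν⟩ : PBond (F.P Kt) 0) ∈ {b : PBond (F.P Kt) 0 | b.src ∈ maxDomT ν.M₁ Z 1 ∨ b.tgt ∈ maxDomT ν.M₁ Z 1} ∨
      (⟨p.src.shift p.ν, p.μ⟩ : PBond (F.P Kt) 0) ∈ {b : PBond (F.P Kt) 0 | b.src ∈ maxDomT ν.M₁ Z 1 ∨ b.tgt ∈ maxDomT ν.M₁ Z 1} ∨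
      (⟨p.src, p.ν⟩ : PBond (F.P Kt) 0) ∈ {b : PBond (F.P Kt) 0 | b.src ∈ maxDomT ν.M₁ Z 1 ∨ b.tgt ∈ maxDomT ν.M₁ Z 1}) :
    ‖((GaugeField.plaqHol U₀ p : SU2) : Matrix (Fin 2) (Fin 2) ℂ) - 1‖ ≤ δ := by
  have hp' : p ∈ plaqsOf (Node00.topSeq (Node00.suppDomOfRecord F ν Kt (maxDomT ν.M₁ Z)) (maxDomT ν.M₁ Z) 1) := by
    rw [Node00.topSeq_of_ne_zero _ _ one_ne_zero, mem_plaqsOf]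
    simp only [Set.mem_setOf_eq, PBond.tgt] at hp
    rcases hp with (h | h) | (h | h) | (h | h) | (h | h)
    · exact Or.inl h
    · exact Or.inr (Or.inl h)
    · exact Or.inr (Or.inl h)
    · exact Or.inr (Or.inr (Or.inr h))
    · exact Or.inr (Or.inr (Or.inl h))
    · rw [Site.shift_comm] at h
      exact Or.inr (Or.inr (Or.inr h))
    · exact Or.inl h
    · exact Or.inr (Or.inr (Or.inl h))
  have h := dist1_plaqHol_lt_of_mem_class ν Kt k (maxDomT ν.M₁ Z) hmin.1 hε hk hp'
  have e : dist1 (GaugeField.plaqHol U₀ p) = ‖((GaugeField.plaqHol U₀ p : SU2) : Matrix (Fin 2) (Fin 2) ℂ) - 1‖ := rfl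
  rw [e] at h
  linarith

end

end Literature.MathematicalPhysics.QuantumFieldTheory.Balaban1983to89.B15Prop1PlaquetteLettersOfClassB

end
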